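import Summits.KontsevichZagierPeriods.KontsevichZagierPeriods.Theses.HurwitzMicroSectors
import Summits.KontsevichZagierPeriods.KontsevichZagierPeriods.Theorems.HurwitzMicroSectorsNormalFormPrinciplePiBoxTransfer
import Summits.KontsevichZagierPeriods.KontsevichZagierPeriods.Theorems.HurwitzMicroSectorsNormalFormPrincipleVariants2238

/-! TTRL-lite variant V2318 of stmt-KontsevichZagierPeriods-3869

Variant V2318 = `stub_boxRigidity` (the leaf `BoxRigidity` of `NormalFormPrinciple`: two representations
on open unit boxes with integrands of KZ's rational shape `p/q` over `ℚ` and equal values are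
KZ-equivalent) under the two-sided small-case move `bound_nat:m≤6; bound_nat:m'≤8`. Verdict of the
attempt seat: **open** — this file is the exact-strength certificate, not a proof of the variant. For
every `K` let `BoxVanishing K` say that a box-rational representation of dimension `K` and value `0` is a
relation. By the tree's padding lemmas (`…Variants2238`: compare with the zero representation on the
other box one way; pad both representations to the common box by Newton–Leibniz moves and null faces and
subtract there the other way, value `0` by soundness `relations_le_ker_eval_holds`) the variant is pinned
exactly: `V2318 ⟺ BoxVanishing 8 ⟺ BoxRigidity for all m, m' ≤ 8` (= the siblings V2336, V2300)
(`stub_boxRigidity_var2318_iff_boxVanishing_eight`, `…_iff_le_eight`, `…_iff_bound_eight_eight`): the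
bound `m ≤ 6` loses nothing against `m' ≤ 8`. That is Conjecture 1 of Kontsevich–Zagier for all pairs of rational
integrands on the boxes `(0,1)^{≤ 8}` (`π², …, π⁸`, `ζ(3)`, `ζ(5)`, `ζ(7)`, `ζ(3)ζ(5)`, every multiple
zeta value of weight `≤ 8`, Catalan's `G`); in particular it contains, for `a b : ℚ`,
"`a + b·ζ(5) = 0 ⇒ [a + b/(1 − x₁⋯x₅)]_{(0,1)⁵}` is a relation" and the same dichotomy for `G`, decided
today by no theorem (irrationality open; by soundness a chain of moves exists for at most one ratio
`a : b`). The proved two-sided instance of the tree is `m, m' ≤ 1` (Baker). Conversely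
`KontsevichZagierPeriods ⇒ parent ⇒ V2318` (`stub_boxRigidity_var2318_of_statement`), so a refutation of
the variant would refute the Summit, and the tree has no invariant of `KZ.relations` finer than `eval`.
Source: M. Kontsevich, D. Zagier, *Periods* (2001), §1.2 Conjecture 1. Pure proof file, no definitions. -/

-- `Summit.<Summit>.<Problem>` is the tree's mandated summit-side namespace (CONVENTIONS §2); for this
-- single-conjunct summit the two coincide, so the duplicate is deliberate.
set_option linter.dupNamespace false

noncomputable section

namespace Summit.KontsevichZagierPeriods.KontsevichZagierPeriods.Theorems

open MeasureTheory Set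
open Literature.NumberTheory.Transcendental Literature.NumberTheory.Transcendental.KZ
open Summit.KontsevichZagierPeriods.KontsevichZagierPeriods.Theses.HurwitzMicroSectors
open Summit.KontsevichZagierPeriods.HurwitzMicroSectors.NormalFormPrinciple.PiBox

/-! ## The variant V2318 is exactly `BoxVanishing 8` -/

/-- **V2318 ⟺ `BoxVanishing 8`**: (⇒) the pair of dimensions `(6, 8)` is allowed, so compare a vanishing
box-rational representation on `(0,1)⁸` with the zero representation on `(0,1)⁶`
(`boxVanishingDim_right_of_pair 6 8`); (⇐) pad both representations to the `8`-box and subtract there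
(`boxRigidityLe_of_boxVanishingDim 8`, `m ≤ 6 ≤ 8`, `m' ≤ 8`). [cite: KontsevichZagier2001, §1.2 Conjecture 1] -/
theorem stub_boxRigidity_var2318_iff_boxVanishing_eight :
    (∀ (m m' : ℕ) (N : IntegralRep m) (N' : IntegralRep m'), m' ≤ 8 → m ≤ 6 → N.domain = {x | ∀ i, x i ∈ Set.Ioo (0:ℝ) 1} → N.IsRational → N'.domain = {x | ∀ i, x i ∈ Set.Ioo (0:ℝ) 1} → N'.IsRational → N.value = N'.value → Equivalent N N') ↔
    (∀ (M : IntegralRep 8), M.domain = {x | ∀ i, x i ∈ Set.Ioo (0:ℝ) 1} → M.IsRational →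
      M.value = 0 → of M ∈ relations) :=
  ⟨fun h => boxVanishingDim_right_of_pair 6 8 fun N N' => h 6 8 N N' le_rfl le_rfl,
    fun hvan m m' N N' hm' hm =>
      boxRigidityLe_of_boxVanishingDim 8 hvan m m' N N' (hm.trans (by norm_num)) hm'⟩

/-- **V2318 ⟺ BoxRigidity for all dimensions `m, m' ≤ 8`** (the honest strength of the variant: the
bound `m ≤ 6` may be relaxed to `m ≤ 8` for free). [cite: KontsevichZagier2001, §1.2 Conjecture 1] -/
theorem stub_boxRigidity_var2318_iff_le_eight :
    (∀ (m m' : ℕ) (N : IntegralRep m) (N' : IntegralRep m'), m' ≤ 8 → m ≤ 6 → N.domain = {x | ∀ i, x i ∈ Set.Ioo (0:ℝ) 1} → N.IsRational → N'.domain = {x | ∀ i, x i ∈ Set.Ioo (0:ℝ) 1} → N'.IsRational → N.value = N'.value → Equivalent N N') ↔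
    (∀ (m m' : ℕ) (N : IntegralRep m) (N' : IntegralRep m'), m ≤ 8 → m' ≤ 8 →
      N.domain = {x | ∀ i, x i ∈ Set.Ioo (0:ℝ) 1} → N.IsRational →
      N'.domain = {x | ∀ i, x i ∈ Set.Ioo (0:ℝ) 1} → N'.IsRational →
      N.value = N'.value → Equivalent N N') := by
  rw [stub_boxRigidity_var2318_iff_boxVanishing_eight]
  exact ⟨fun hvan => boxRigidityLe_of_boxVanishingDim 8 hvan,
    fun h => boxVanishingDim_left_of_pair 8 8 fun N N' => h 8 8 N N' le_rfl le_rfl⟩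

/-- **V2318 ⟺ the sibling V2336** (`bound_nat:m≤8; bound_nat:m'≤8`, stated here literally so that no
sibling file is imported): both are `BoxVanishing 8` — the smaller left bound `6` is immaterial.
[cite: KontsevichZagier2001, §1.2 Conjecture 1] -/
theorem stub_boxRigidity_var2318_iff_bound_eight_eight :
    (∀ (m m' : ℕ) (N : IntegralRep m) (N' : IntegralRep m'), m' ≤ 8 → m ≤ 6 → N.domain = {x | ∀ i, x i ∈ Set.Ioo (0:ℝ) 1} → N.IsRational → N'.domain = {x | ∀ i, x i ∈ Set.Ioo (0:ℝ) 1} → N'.IsRational → N.value = N'.value → Equivalent N N') ↔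
    (∀ (m m' : ℕ) (N : IntegralRep m) (N' : IntegralRep m'), m' ≤ 8 → m ≤ 8 →
      N.domain = {x | ∀ i, x i ∈ Set.Ioo (0:ℝ) 1} → N.IsRational →
      N'.domain = {x | ∀ i, x i ∈ Set.Ioo (0:ℝ) 1} → N'.IsRational →
      N.value = N'.value → Equivalent N N') := by
  rw [stub_boxRigidity_var2318_iff_boxVanishing_eight]
  exact ⟨fun hvan m m' N N' hm' hm => boxRigidityLe_of_boxVanishingDim 8 hvan m m' N N' hm hm',
    fun h => boxVanishingDim_left_of_pair 8 8 fun N N' => h 8 8 N N' le_rfl le_rfl⟩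

/-- **V2318 ⇒ `BoxVanishing` in every dimension `j ≤ 8`** (monotonicity in the dimension, by padding,
`boxVanishingDim_mono`); `j = 5` is the `ζ(5)`-dichotomy and `j = 2` Catalan's — the residual, open
content of the variant. [cite: KontsevichZagier2001, §1.2 Conjecture 1] -/
theorem boxVanishing_le_eight_of_stub_boxRigidity_var2318
    (h : ∀ (m m' : ℕ) (N : IntegralRep m) (N' : IntegralRep m'), m' ≤ 8 → m ≤ 6 → N.domain = {x | ∀ i, x i ∈ Set.Ioo (0:ℝ) 1} → N.IsRational → N'.domain = {x | ∀ i, x i ∈ Set.Ioo (0:ℝ) 1} → N'.IsRational → N.value = N'.value → Equivalent N N')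
    {j : ℕ} (hj : j ≤ 8) (N : IntegralRep j) (hNd : N.domain = {x | ∀ i, x i ∈ Set.Ioo (0:ℝ) 1})
    (hNr : N.IsRational) (hv : N.value = 0) : of N ∈ relations :=
  boxVanishingDim_mono hj (stub_boxRigidity_var2318_iff_boxVanishing_eight.1 h) N hNd hNr hv

/-- **The parent leaf ⇒ V2318** (the variant is a specialisation of `stub_boxRigidity`; the converse is
not claimed — the parent is `BoxVanishing` in ALL dimensions). [cite: KontsevichZagier2001, §1.2 Conjecture 1] -/
theorem stub_boxRigidity_var2318_of_parent
    (h : ∀ (m m' : ℕ) (N : IntegralRep m) (N' : IntegralRep m'), N.domain = {x | ∀ i, x i ∈ Set.Ioo (0:ℝ) 1} → N.IsRational → N'.domain = {x | ∀ i, x i ∈ Set.Ioo (0:ℝ) 1} → N'.IsRational → N.value = N'.value → Equivalent N N') :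
    ∀ (m m' : ℕ) (N : IntegralRep m) (N' : IntegralRep m'), m' ≤ 8 → m ≤ 6 → N.domain = {x | ∀ i, x i ∈ Set.Ioo (0:ℝ) 1} → N.IsRational → N'.domain = {x | ∀ i, x i ∈ Set.Ioo (0:ℝ) 1} → N'.IsRational → N.value = N'.value → Equivalent N N' :=
  fun m m' N N' _ _ => h m m' N N'

/-- **`KontsevichZagierPeriods ⇒ V2318`**: the variant is a special case of Conjecture 1 for the
tree's calculus (`leaves_of_statement`) — so a refutation of the variant would refute the Summit.
[cite: KontsevichZagier2001, §1.2 Conjecture 1] -/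
theorem stub_boxRigidity_var2318_of_statement (h : _root_.KontsevichZagierPeriods) :
    ∀ (m m' : ℕ) (N : IntegralRep m) (N' : IntegralRep m'), m' ≤ 8 → m ≤ 6 → N.domain = {x | ∀ i, x i ∈ Set.Ioo (0:ℝ) 1} → N.IsRational → N'.domain = {x | ∀ i, x i ∈ Set.Ioo (0:ℝ) 1} → N'.IsRational → N.value = N'.value → Equivalent N N' :=
  stub_boxRigidity_var2318_of_parent (leaves_of_statement h).1

end Summit.KontsevichZagierPeriods.KontsevichZagierPeriods.Theorems

end
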